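import Summits.QuantumFields.YangMills.Theorems.BalabanUVNodesK0AxMomentDoor
import Summits.QuantumFields.YangMills.Theorems.BalabanUVNodesK0AxTwoVolumeRate

/-!
# LANDING NOTE (porter PTC-1 g3, `ymgap-nodeO-port-PTC-1`; ★ P3 g89's THIRD-FILE OFFER nodeO STATUS 2026-08-31T07:28:31Z «land `nodeO-cover/P3-K0AxMomentBox-v2.lean` verbatim as
# `…/Theorems/BalabanUVNodesK0AxMomentBox.lean` `--supports stmt-QuantumFields-27238 --as helper`»).  AUTHORSHIP = ★ P3 g89, HOME sketch `P3-K0AxMomentBox-v2.lean` (6587fefcb2367846 ·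
# 435 l. · 27 thm · 5 def; farm rc 0 at P3's desk).  LANDED AS TWO FILES (435 l. > the 400-line cap): THIS FILE `…K0AxMomentBox.lean` = §5 up to the doors (box letters
# `RecordPlimAbsMomentOnBoxAx` ∕ `RecordPvolAbsMomentOnBoxAx`, their order, box ⟹ runs, the |β|-box, doors (μ_cof^box)-Ax ∕ (μ_cof^box,vol)-Ax and K0ᴬ BY NAME); the companion
# `…K0AxMomentBoxSocket.lean` = the K1ᴬ socket face (`CofinalBetaSocketAxBody` + its doors) and §5d the [E]-headed rate-free doors.  ONE lander's edit: the two 0-binder door Props'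
# docstrings carry their [I] locators in prose (no `cite` tag), as in ✓`…K0AxMomentDoor.lean`, so the gate's inline-fact relocation cannot fire on a hypothesis-shaped door.
# Declarations and proofs byte-identical to the sketch; P3's module docstring follows unchanged.
-/

/-!
# LENS P3 «weaken the target» — THE BOX TWIN OF THE MOMENT DOOR AND ITS K1ᴬ SOCKET FACE (★ P3 g89, sketch `nodeO-cover/P3-K0AxMomentBox-v1.lean`)

Third file of the moment road, after ▶ PTC-1 g3's landings of ★ P3 g89's v1: ✓p814271 `…K0AxMomentRoad.lean` (§1 generic rate-free analysis, §2 run letters, §4 JOIN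
shapes) and ✓p814339 `…K0AxMomentDoor.lean` (§3 run doors (μ_cof)-Ax `K0AbsMomentCofinalRadiiAx` ∕ (μ_cof^vol)-Ax `K0PvolAbsMomentCofinalRadiiAx` ⟹ K0ᴬ BY NAME) and ✓`…K0AxTwoVolumeRate.lean` (◇ lens-1 g8, ▶ PTC-1: the letter [E]) — the TWO
imports.  Same namespace `…Theorems.K0AxMomentRoad`.  DEDUP-SAFE: no theorem below has the statement of a landed declaration (the p814295 lesson: a second proof of a landed
statement is `dedup.landed`); the two roads to K0ᴬ are recorded as CONJUNCTIONS `doors_of_…`, never as same-statement twins.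

WHAT THIS FILE TYPES (the §5 of the HOME sketch `P3-K0AxMomentDoor-v1_1.lean` 746 l.: letters ∕ order ∕ K1ᴬ face byte-identical; the K0ᴬ doors re-proved through `doors_of_…`):
* (L-absmom-box) `RecordPlimAbsMomentOnBoxAx F a₀ ε₂₉ γ M` ∕ (V-absmom-box) `RecordPvolAbsMomentOnBoxAx F a₀ ε₂₉ γ M` — box-uniform (ONE `M` for all steps `k` and box
  histories `v`) absolute `(0,1)`-second moments of DEF-1's record kernels `recordPlimAx` ∕ (windowed, frequently in the volume) `recordPvolAx` of the `thetaFill` member;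
* their order: box (5.10)-decay receipts ⟹ box moments (`M := β′₅.₁₀`); dag-n07-w3's `∀ S : Finset, ∀ᶠ K` face shape ⟹ the window shape (`exists_window_of_forall_finset_eventually`,
  diagonal `Nat.findGreatest` thresholds along the monotone boxes `[−K, K]⁴`); ★ Fatou on the box `recordPlimAbsMomentOnBoxAx_of_pvol` (rate-free); box ⟹ runs;
* ★ `betaBox_thetaFill_of_recordPlimAbsMomentOnBoxAx`: (L-absmom-box) at level `γ ≤ ½` ⟹ `BetaUpperH M γ β ∧ BetaLowerH (−M) γ β` for `β := betaOfRecord₁₃Ax F 2 (thetaFill F a₀ ε₂₉)`;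
* doors (μ_cof^box)-Ax `K0AbsMomentBoxCofinalRadiiAx` ∕ (μ_cof^box,vol)-Ax `K0PvolAbsMomentBoxCofinalRadiiAx` (0-binder, cofinal radii) ⟹ door (α_cof)-Ax
  `K0V23Stub3DoorSuppliersAx.K0BoxCofinalRadiiAx` AND run door (μ_cof)-Ax (resp. (μ_cof^vol)-Ax) of ✓`…K0AxMomentDoor` — `doors_of_…`: the box moment door sits above
  BOTH roads — ⟹ ★★★ K0ᴬ `Record13SepCoPHInhabitedAx` BY NAME on k0's BOX road;
* the K0ᴬ–K1ᴬ junction's binder body `CofinalBetaSocketAxBody F a` (VERBATIM the text under `∀ F, ∀ a, 0 < a →` of the last binder of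
  `BalabanUVNodes.N24K0K1JunctionOfCofinalBetaSocketAx.k0BoxCofinalRadiiAx_of_cofinalBetaSocketAx`; restated, not imported, so this file stays junction-free) and ★★
  `cofinalBetaSocketAxBody_of_absMomentBox_of_floor_of_cont` — THE TYPED LENS-P3 EDGE TABLE AT K1ᴬ: (L-absmom-box) feeds the socket's |β| half (box `β′ := M` + row (i)
  `b := 0, r := M`); the partial-sum FLOOR (iv) (AF-sign, [I] (5.38)–(5.44)) and the history-CONTINUITY (C) ([I] §1 pp.263–264) stay DISPLAYED — they are in no
  kernel-size currency and were never fed by (5.10)-decay either, so the moment currency loses no K1ᴬ edge; K2ᴬ is proved, K3ᴬ is kernel-free.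
* §5d [E]-HEADED doors (★★★ №526 (i)): `joinConclVolMomR_of_twoVolExp_pvolAbsMoment_threshold` ([E] ∧ (V-absmom) in threshold form under the JOIN antecedents ⟹
  `JoinConclVolMomR`), ★★★ `record13SepCoPHInhabitedAx_of_twoVolExp_pvolAbsMoment_tokFree` (the RATE-FREE sibling of ✓`K0AxTwoVolumeRate.…_of_twoVolExp_pvolDecayEv_tokFree`:
  their rated `hDec` replaced by the weaker windowed-moment supply `hVmom`; P0 binders verbatim) and ★★★ `…_of_twoVolExp_pvolAbsMoment_cofinalRadii` ([E] ∧ (V-absmom) at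
  cofinal radii ⟹ K0ᴬ through (μ_cof^vol)-Ax; no P0, no JOIN).

PRIOR TREE ART (credit).  The moment currency ON THE BOX at EVERY radius is k0-s3-w2's repaired finite-volume currency (R1′)∕(R2′) re-homed in dag-n07-w3's
`K0V23Stub3FinVolSuppliersAx` (private `abs_secondMoment_polLimit_le_of_eventually`; ★★ `abs_betaOfRecord₁₃Ax_le_of_eventualAbsMomentOnBox`; ★★ `tokenFreeZBAx_of_momentFaceAtZB`
⟹ K0ᴬ via `K0V23Stub3DoorSuppliersAx.k0BoxSmallRadii_of_tokenFreeCore` + `record13SepCoPHInhabitedAx_of_k0BoxSmallRadii`).  Delta here: record names, COFINAL radii, the weaker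
window quantifier, the (α_cof) road, the K1ᴬ face.

HONEST.  CONDITIONAL helpers: every door ∕ letter is an OPEN Bałaban-strength hypothesis ([I] (1.21)–(1.22), (4.37), (5.42) at the record) — none proved; nothing of
Bałaban asserted, ported, discharged or refuted; K0ᴬ `stmt-QuantumFields-27238` OPEN; K1ᴬ OPEN; NODE O 0∕1; finite 𝕋⁴ at fixed `ε = L^(−K)` — NOT continuum ∕ OS ∕ Clay;
**the Yang–Mills mass gap is NOT proved by any of this.**  No `sorry` ∕ `instance` ∕ `notation`.
-/

noncomputable section

open scoped BigOperators Matrix.Norms.L2Operator Topology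
open Set Filter

namespace Summit.QuantumFields.YangMills.Theorems.K0AxMomentRoad

open Summit.QuantumFields.YangMills.Theorems.K0RecordFormatNames
open Summit.QuantumFields.YangMills.Theorems
open Summit.QuantumFields.YangMills.Theorems.PortHRecordJoin
open Summit.QuantumFields.YangMills.Theorems.K0AxTwoVolumeRate (RecordPvolTwoVolExpOnRunsAx recordPolLimitOnRunsAx_of_twoVolExp)
open Literature.MathematicalPhysics.QuantumFieldTheory.Balaban1983to89
open Literature.MathematicalPhysics.QuantumFieldTheory.Balaban1983to89.Node00
open Literature.MathematicalPhysics.QuantumFieldTheory.Balaban1983to89.T4Continuum (T4Family)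
open Literature.MathematicalPhysics.QuantumFieldTheory.Balaban1983to89.FlowStep
open Literature.MathematicalPhysics.QuantumFieldTheory.Balaban1983to89.FlowStepRuns
open Literature.MathematicalPhysics.QuantumFieldTheory.Balaban1983to89.B12Sec2to5 (l1 Decay510 betaPrime510 majorant_summable)

variable (F : T4Family) (a₀ ε₂₉ : ℝ)

/-! ## §5  (v1.1, APPEND-ONLY) THE BOX TWIN AND THE K1ᴬ SOCKET FACE — (L-absmom-box) ∕ (V-absmom-box) at the record, the (α_cof) road to K0ᴬ BY NAME,
the order against dag-n07-w3's `∀ S ∀ᶠ K` moment face, and what the moment currency feeds of the K0ᴬ–K1ᴬ junction's binder `hβc` (the |β| half: box + row (i))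
and what it cannot feed (the partial-sum floor (iv) and the history-continuity (C), displayed as hypotheses) — the typed LENS-P3 edge table at K1ᴬ.

PRIOR TREE ART (credit).  The moment currency ON THE BOX is k0-s3-w2's repaired finite-volume currency (R1′)∕(R2′), re-homed in dag-n07-w3's
`K0V23Stub3FinVolSuppliersAx` (σ-image of ✓p771057): private `abs_secondMoment_polLimit_le_of_eventually` (Fatou for sums, hypothesis `∀ S : Finset, ∀ᶠ K,
Σ_{z∈S} |Π_K(z) z_0 z_1| ≤ M` on def-B's merged family at a θ-generic tuple), ★★ `abs_betaOfRecord₁₃Ax_le_of_eventualAbsMomentOnBox` ∕ `_of_fundamentalDomainAbsMomentOnBox`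
and ★★ `tokenFreeZBAx_of_momentFaceAtZB` (EVERY radius ⟹ the token-free core ⟹ K0ᴬ by `K0V23Stub3DoorSuppliersAx.k0BoxSmallRadii_of_tokenFreeCore` +
`record13SepCoPHInhabitedAx_of_k0BoxSmallRadii`).  What this section adds: the box letters at DEF-1's record names `recordPlimAx ∕ recordPvolAx` of the `thetaFill`
member, COFINAL radii, the weaker window quantifier `∃ W ∧ ∃ᶠ K` (paid by `∀ S ∀ᶠ K`: `exists_window_of_forall_finset_eventually`), the (α_cof) road, and the K1ᴬ face. -/

/-- `ℤᵈ` is exhausted by the MONOTONE finite boxes `[−K, K]ᵈ`. [folklore] -/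
theorem exists_monotone_finset_exhaustion_zd (d : ℕ) :
    ∃ V : ℕ → Finset (Fin d → ℤ), Monotone V ∧ ∀ x, ∀ᶠ K in atTop, x ∈ V K := by
  refine ⟨fun K => Fintype.piFinset fun _ : Fin d => Finset.Icc (-(K : ℤ)) K, fun K K' hKK' => ?_, fun x => ?_⟩
  · exact Fintype.piFinset_subset _ _ fun _ => Finset.Icc_subset_Icc (by omega) (by omega)
  · refine (eventually_ge_atTop (∑ i, (x i).natAbs)).mono fun K hK => ?_
    refine Fintype.mem_piFinset.2 fun i => Finset.mem_Icc.2 ?_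
    have hi : (x i).natAbs ≤ K := (Finset.single_le_sum (fun j _ => Nat.zero_le _) (Finset.mem_univ i)).trans hK
    have habs : |x i| ≤ (K : ℤ) := by rw [Int.abs_eq_natAbs]; exact_mod_cast hi
    exact abs_le.1 habs

/-- **THE `∀ S ∀ᶠ K` FACE PAYS THE WINDOW FACE** (order against `K0V23Stub3FinVolSuppliersAx`'s (R1′) hypothesis shape): if for EVERY finite `S` the truncated sums are
EVENTUALLY `≤ M`, then along any MONOTONE exhaustion `V` the windows `W K := V (m K)`, `m K :=` the greatest `m ≤ K` whose `S := V m`-threshold is `≤ K`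
(`Nat.findGreatest`, diagonal thresholds), exhaust the index set and carry `Σ_{x ∈ W K} f K x ≤ M` EVENTUALLY (a fortiori frequently).  The converse is not claimed.
[folklore] -/
theorem exists_window_of_forall_finset_eventually {X : Type*} {f : ℕ → X → ℝ} {M : ℝ} (V : ℕ → Finset X) (hVm : Monotone V)
    (hV : ∀ x, ∀ᶠ K in atTop, x ∈ V K) (h : ∀ S : Finset X, ∀ᶠ K in atTop, ∑ x ∈ S, f K x ≤ M) :
    ∃ W : ℕ → Finset X, (∀ x, ∀ᶠ K in atTop, x ∈ W K) ∧ ∀ᶠ K in atTop, ∑ x ∈ W K, f K x ≤ M := by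
  choose N hN using fun m => eventually_atTop.1 (h (V m))
  refine ⟨fun K => V (Nat.findGreatest (fun m => N m ≤ K) K), fun x => ?_, ?_⟩
  · obtain ⟨m₀, hm₀⟩ := eventually_atTop.1 (hV x)
    refine eventually_atTop.2 ⟨max m₀ (N m₀), fun K hK => ?_⟩
    have hle : m₀ ≤ Nat.findGreatest (fun m => N m ≤ K) K :=
      Nat.le_findGreatest ((le_max_left _ _).trans hK) ((le_max_right _ _).trans hK)
    exact hVm hle (hm₀ m₀ le_rfl)
  · refine eventually_atTop.2 ⟨N 0, fun K hK => hN _ K ?_⟩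
    exact Nat.findGreatest_spec (P := fun m => N m ≤ K) (Nat.zero_le K) hK

/-- **(L-absmom-box) — RECEIPT «BOX-UNIFORM ABSOLUTE SECOND MOMENT OF THE LIMIT ACTIVITIES AT THE RECORD»**: at every step `k` and every box history
`v ∈ ]0, γ]^{k+1}` the absolute `(0, 1)`-moment of the LIMIT kernel `recordPlimAx F a₀ ε₂₉ k v` is summable and `≤ M` — ONE `M`, UNIFORM in the step `k` and the box
history `v` (the whole strength; per-`(k, v)` finiteness is junk-cheap).  Pays the run letter (L-absmom) at every
level `γ₀ ≤ γ` and the |β|-box of doors (α); strictly between the box (5.10)-decay receipt `PlimDecayOnBoxOf … (recordTermsAx …)` and the |β|-box letter.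
(HYPOTHESIS SHAPE — bookkeeping over accepted tree names, NOT a published result as typed; open.) [cite: Balaban1987RG1, Thm 3 p.264 («uniformly bounded»), (1.21)–(1.22) p.264, (5.42) p.297] -/
def RecordPlimAbsMomentOnBoxAx (γ M : ℝ) : Prop :=
  ∀ (k : ℕ) (v : Fin (k + 1) → ℝ), v ∈ Box γ k →
    Summable (fun z : Fin 4 → ℤ => |recordPlimAx F a₀ ε₂₉ k v 0 1 z| * |(z 0 : ℝ)| * |(z 1 : ℝ)|) ∧
      ∑' z : Fin 4 → ℤ, |recordPlimAx F a₀ ε₂₉ k v 0 1 z| * |(z 0 : ℝ)| * |(z 1 : ℝ)| ≤ M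

/-- **(V-absmom-box) — RECEIPT «WINDOWED ABSOLUTE SECOND MOMENTS PER VOLUME, FREQUENTLY, ON THE BOX, AT THE RECORD»**: at every box history SOME finite windows
`W K ⊂ ℤ⁴` exhausting `ℤ⁴` (`∀ z, ∀ᶠ K, z ∈ W K`) on which FREQUENTLY in `K` the truncated absolute `(0, 1)`-moment of the FINITE-VOLUME kernel `recordPvolAx … K` is
`≤ M` — ONE `M`, UNIFORM in `k`, `v` (and frequently in `K`).  No all-`z` finite-volume letter (periodicity guard), no rate.  (HYPOTHESIS SHAPE; open.) [cite: Balaban1987RG1, (1.20)–(1.21) p.264, (4.37) p.291, (5.42) p.297] -/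
def RecordPvolAbsMomentOnBoxAx (γ M : ℝ) : Prop :=
  ∀ (k : ℕ) (v : Fin (k + 1) → ℝ), v ∈ Box γ k →
    ∃ W : ℕ → Finset (Fin 4 → ℤ), (∀ z, ∀ᶠ K in atTop, z ∈ W K) ∧
      ∃ᶠ K in atTop, ∑ z ∈ W K, |recordPvolAx F a₀ ε₂₉ k v K 0 1 z| * |(z 0 : ℝ)| * |(z 1 : ℝ)| ≤ M

/-- **(L-dec-box) ⟹ (L-absmom-box)** with `M := β′₅.₁₀ = betaPrime510 4 C δ₁` (the box decay receipt of `K0RecordFormatNamesDecay` at `recordTermsAx`, as read by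
`recordPlimDecayOnRunsAx_of_plimDecayOnBoxOf`). [cite: Balaban1987RG1, (5.10) p.293, (5.42) p.297] -/
theorem recordPlimAbsMomentOnBoxAx_of_plimDecayOnBoxOf {γ C δ₁ : ℝ}
    (h : letI θ := thetaFill F a₀ ε₂₉
      letI := θ.instVβ₁; letI := θ.instVβ₂; letI := θ.instιβ
      PlimDecayOnBoxOf F (recordTermsAx F a₀ ε₂₉) θ.ρ8 θ.bV γ C δ₁) :
    RecordPlimAbsMomentOnBoxAx F a₀ ε₂₉ γ (betaPrime510 4 C δ₁) := by
  intro k v hv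
  exact summable_absMoment_of_decay510 h.1 (h.2 k v hv) 0 1

/-- **(V-dec-ev-box) ⟹ (V-absmom-box)** with `M := β′₅.₁₀` (windows built from the thresholds; the bound then holds at EVERY volume). [cite: Balaban1987RG1, (4.37) p.291, (5.10) p.293, (5.42) p.297] -/
theorem recordPvolAbsMomentOnBoxAx_of_pvolDecayEvOnBoxOf {γ C δ₁ : ℝ}
    (h : letI θ := thetaFill F a₀ ε₂₉
      letI := θ.instVβ₁; letI := θ.instVβ₂; letI := θ.instιβ
      PvolDecayEvOnBoxOf F (recordTermsAx F a₀ ε₂₉) θ.ρ8 θ.bV γ C δ₁) :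
    RecordPvolAbsMomentOnBoxAx F a₀ ε₂₉ γ (betaPrime510 4 C δ₁) := by
  intro k v hv
  obtain ⟨V, hV⟩ := exists_finset_exhaustion_zd 4
  have hev : ∀ z : Fin 4 → ℤ, ∀ᶠ K in atTop,
      |recordPvolAx F a₀ ε₂₉ k v K 0 1 z| * |(z 0 : ℝ)| * |(z 1 : ℝ)| ≤ C * (l1 z ^ 2 * Real.exp (-δ₁ * l1 z)) :=
    fun z => (h.2 k v hv z).mono fun K hK => absMomentTerm_le_of_abs_le hK 0 1
  have hm : ∀ z : Fin 4 → ℤ, 0 ≤ C * (l1 z ^ 2 * Real.exp (-δ₁ * l1 z)) := by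
    intro z
    obtain ⟨K, hK⟩ := (hev z).exists
    exact (absMomentTerm_nonneg _ 0 1 z).trans hK
  obtain ⟨W, hW, hsum⟩ := exists_window_sum_le_of_eventually_le V hV hev hm ((majorant_summable h.1 4).mul_left C)
  refine ⟨W, hW, Frequently.of_forall fun K => (hsum K).trans_eq ?_⟩
  rw [tsum_mul_left]
  rfl

/-- **dag-n07-w3's `∀ S ∀ᶠ K` face (read at the record names) ⟹ (V-absmom-box)** (`exists_window_of_forall_finset_eventually` along the monotone boxes).
[cite: Balaban1987RG1, (1.21)–(1.22) p.264 (bookkeeping)] -/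
theorem recordPvolAbsMomentOnBoxAx_of_finsetEventually {γ M : ℝ}
    (h : ∀ (k : ℕ) (v : Fin (k + 1) → ℝ), v ∈ Box γ k → ∀ S : Finset (Fin 4 → ℤ), ∀ᶠ K in atTop,
      ∑ z ∈ S, |recordPvolAx F a₀ ε₂₉ k v K 0 1 z| * |(z 0 : ℝ)| * |(z 1 : ℝ)| ≤ M) :
    RecordPvolAbsMomentOnBoxAx F a₀ ε₂₉ γ M := by
  intro k v hv
  obtain ⟨V, hVm, hV⟩ := exists_monotone_finset_exhaustion_zd 4
  obtain ⟨W, hW, hev⟩ := exists_window_of_forall_finset_eventually V hVm hV (h k v hv)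
  exact ⟨W, hW, hev.frequently⟩

/-- ★ **(L-lim-box) ∧ (V-absmom-box) ⟹ (L-absmom-box), RATE-FREE** (Fatou through the windows at every box history; the (1.21) box letter is
`K0RecordFormatNamesDecay.PolLimitOnBoxOf` at `recordTermsAx`). [cite: Balaban1987RG1, (1.21)–(1.22) p.264, (5.42) p.297] -/
theorem recordPlimAbsMomentOnBoxAx_of_pvol {γ M : ℝ}
    (hlim : letI θ := thetaFill F a₀ ε₂₉
      letI := θ.instVβ₁; letI := θ.instVβ₂; letI := θ.instιβ
      PolLimitOnBoxOf F (recordTermsAx F a₀ ε₂₉) θ.ρ8 θ.bV γ)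
    (h : RecordPvolAbsMomentOnBoxAx F a₀ ε₂₉ γ M) : RecordPlimAbsMomentOnBoxAx F a₀ ε₂₉ γ M := by
  intro k v hv
  obtain ⟨W, hW, hM⟩ := h k v hv
  letI θ := thetaFill F a₀ ε₂₉
  letI := θ.instVβ₁; letI := θ.instVβ₂; letI := θ.instιβ
  have ht : ∀ z : Fin 4 → ℤ, Tendsto (fun K => |recordPvolAx F a₀ ε₂₉ k v K 0 1 z| * |(z 0 : ℝ)| * |(z 1 : ℝ)|) atTop
      (𝓝 (|recordPlimAx F a₀ ε₂₉ k v 0 1 z| * |(z 0 : ℝ)| * |(z 1 : ℝ)|)) := fun z =>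
    ((((continuous_abs.tendsto _).comp
      (tendsto_pvolOf F (recordTermsAx F a₀ ε₂₉) θ.ρ8 θ.bV k v (hlim k v hv) 0 1 z)).mul_const _).mul_const _)
  exact summable_and_tsum_le_of_tendsto_of_frequently_sum_le (absMomentTerm_nonneg _ 0 1) (fun K => absMomentTerm_nonneg _ 0 1) ht hW hM

/-- **box ⟹ runs** for the limit letter (a run's prefix lies in `Box γ₀ k ⊆ Box γ k`). [cite: Balaban1987RG1, (0.20) p.256 (bookkeeping)] -/
theorem recordPlimAbsMomentOnRunsAx_of_box {γ γ₀ M : ℝ} (hle : γ₀ ≤ γ) (h : RecordPlimAbsMomentOnBoxAx F a₀ ε₂₉ γ M) :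
    RecordPlimAbsMomentOnRunsAx F a₀ ε₂₉ γ₀ M :=
  fun _ gs _ hI k hk => h k (prefixOf gs k) (box_mono hle (prefixOf_mem_box_of_inInterval hI hk))

/-- **box ⟹ runs** for the finite-volume letter. [cite: Balaban1987RG1, (0.20) p.256 (bookkeeping)] -/
theorem recordPvolAbsMomentOnRunsAx_of_box {γ γ₀ M : ℝ} (hle : γ₀ ≤ γ) (h : RecordPvolAbsMomentOnBoxAx F a₀ ε₂₉ γ M) :
    RecordPvolAbsMomentOnRunsAx F a₀ ε₂₉ γ₀ M :=
  fun _ gs _ hI k hk => h k (prefixOf gs k) (box_mono hle (prefixOf_mem_box_of_inInterval hI hk))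

/-- ★ **(L-absmom-box) ⟹ THE |β|-BOX with `β′ := M`** (level `γ ≤ ½`): on the box the re-centred β IS the (1.22)-moment of `recordPlimAx`
(`betaOfRecord₁₃Ax_thetaFill_of_mem_box`), dominated by the absolute moment.  This pair is ALL that doors (α) and the junction's box conjuncts read.
[cite: Balaban1987RG1, (1.22) p.264, (5.42) p.297, Thm 3 p.264 («uniformly bounded»)] -/
theorem betaBox_thetaFill_of_recordPlimAbsMomentOnBoxAx {γ M : ℝ} (hγh : γ ≤ 1 / 2) (h : RecordPlimAbsMomentOnBoxAx F a₀ ε₂₉ γ M) :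
    BetaUpperH M γ (betaOfRecord₁₃Ax F 2 (thetaFill F a₀ ε₂₉)) ∧ BetaLowerH (-M) γ (betaOfRecord₁₃Ax F 2 (thetaFill F a₀ ε₂₉)) := by
  have key : ∀ (k : ℕ) (v : Fin (k + 1) → ℝ), v ∈ Box γ k → |betaOfRecord₁₃Ax F 2 (thetaFill F a₀ ε₂₉) k v| ≤ M := by
    intro k v hv
    rw [betaOfRecord₁₃Ax_thetaFill_of_mem_box F a₀ ε₂₉ (box_mono hγh hv)]
    obtain ⟨hs, hle⟩ := h k v hv
    exact (summable_and_abs_secondMoment_le_tsum hs).2.trans hle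
  exact ⟨fun k v hv => (abs_le.mp (key k v hv)).2, fun k v hv => (abs_le.mp (key k v hv)).1⟩

/-- **Door (μ_cof^box)-Ax** — for every family and every ceiling `a > 0` SOME radius `0 < a₀ ≤ a`, SOME level `0 < γ₀ ≤ ½`, `ε₂₉ > 0` and `M` with (L-absmom-box).
(HYPOTHESIS — door bookkeeping over accepted tree names, NOT a published result as typed; open.) (locators: [I] Thm 1 p.259, Thm 3 p.264, (1.21)–(1.22) p.264, (5.42) p.297; HYPOTHESIS-shaped door over accepted tree names, open — NOT a published result as typed.)  STRENGTH = UNIFORMITY: ONE `M` for ALL steps `k` and ALL box histories `v` (and, for the finite-volume door, frequently in the volume `K`) — not per-`(k, v)` finiteness. -/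
def K0AbsMomentBoxCofinalRadiiAx : Prop :=
  ∀ F : T4Family, ∀ a : ℝ, 0 < a → ∃ a₀ : ℝ, 0 < a₀ ∧ a₀ ≤ a ∧
    ∃ γ₀ ε₂₉ M : ℝ, 0 < γ₀ ∧ γ₀ ≤ 1 / 2 ∧ 0 < ε₂₉ ∧ RecordPlimAbsMomentOnBoxAx F a₀ ε₂₉ γ₀ M

/-- **Door (μ_cof^box,vol)-Ax** — the FINITE-VOLUME, RATE-FREE box door: cofinally in the radius, the (1.21) BOX letter AND (V-absmom-box).
(HYPOTHESIS — door bookkeeping; open.) (locators: [I] Thm 1 p.259, Thm 3 p.264, (1.20)–(1.21) p.264, (4.37) p.291, (5.42) p.297; HYPOTHESIS-shaped door over accepted tree names, open — NOT a published result as typed.)  STRENGTH = UNIFORMITY: ONE `M` for ALL steps `k` and ALL box histories `v` (and, for the finite-volume door, frequently in the volume `K`) — not per-`(k, v)` finiteness. -/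
def K0PvolAbsMomentBoxCofinalRadiiAx : Prop :=
  ∀ F : T4Family, ∀ a : ℝ, 0 < a → ∃ a₀ : ℝ, 0 < a₀ ∧ a₀ ≤ a ∧
    ∃ γ₀ ε₂₉ M : ℝ, 0 < γ₀ ∧ γ₀ ≤ 1 / 2 ∧ 0 < ε₂₉ ∧
      (letI θ := thetaFill F a₀ ε₂₉
       letI := θ.instVβ₁; letI := θ.instVβ₂; letI := θ.instιβ
       PolLimitOnBoxOf F (recordTermsAx F a₀ ε₂₉) θ.ρ8 θ.bV γ₀) ∧ RecordPvolAbsMomentOnBoxAx F a₀ ε₂₉ γ₀ M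

/-- **(μ_cof^box,vol)-Ax ⟹ (μ_cof^box)-Ax** (Fatou, rate-free). [cite: Balaban1987RG1, (1.21)–(1.22) p.264, (5.42) p.297] -/
theorem k0AbsMomentBoxCofinalRadiiAx_of_pvol (H : K0PvolAbsMomentBoxCofinalRadiiAx) : K0AbsMomentBoxCofinalRadiiAx := by
  intro F a ha
  obtain ⟨a₀, ha₀, hle, γ₀, ε₂₉, M, hγ₀, hγh, hε, hlim, hvol⟩ := H F a ha
  exact ⟨a₀, ha₀, hle, γ₀, ε₂₉, M, hγ₀, hγh, hε, recordPlimAbsMomentOnBoxAx_of_pvol F a₀ ε₂₉ hlim hvol⟩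

/-- **(μ_cof^box)-Ax ⟹ (μ_cof)-Ax** (the box door sits ABOVE §3's run door). [cite: Balaban1987RG1, (0.20) p.256, Thm 3 p.264 (bookkeeping)] -/
theorem k0AbsMomentCofinalRadiiAx_of_box (H : K0AbsMomentBoxCofinalRadiiAx) : K0AbsMomentCofinalRadiiAx := by
  intro F a ha
  obtain ⟨a₀, ha₀, hle, γ₀, ε₂₉, M, hγ₀, hγh, hε, h⟩ := H F a ha
  exact ⟨a₀, ha₀, hle, γ₀, ε₂₉, M, hγ₀, hγh, hε, recordPlimAbsMomentOnRunsAx_of_box F a₀ ε₂₉ le_rfl h⟩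

/-- ★ **(μ_cof^box)-Ax ⟹ door (α_cof)-Ax** `K0V23Stub3DoorSuppliersAx.K0BoxCofinalRadiiAx` (`β′ := M`; member letters `j := 0, ε₀ := B₃ := B₃′ := a₁ := 0,
Efl := logz := 0`, read at the re-centred print-regime member by `rfl` exactly as the run door is). [cite: Balaban1987RG1, Thm 1 p.259, Thm 3 p.264, (1.22) p.264, (5.42) p.297] -/
theorem k0BoxCofinalRadiiAx_of_k0AbsMomentBoxCofinalRadiiAx (H : K0AbsMomentBoxCofinalRadiiAx) : K0V23Stub3DoorSuppliersAx.K0BoxCofinalRadiiAx := by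
  intro F a ha
  obtain ⟨a₀, ha₀, hle, γ₀, ε₂₉, M, hγ₀, hγh, hε, h⟩ := H F a ha
  obtain ⟨hup, hlow⟩ := betaBox_thetaFill_of_recordPlimAbsMomentOnBoxAx F a₀ ε₂₉ hγh h
  exact ⟨a₀, ha₀, hle, γ₀, ε₂₉, M, 0, 0, 0, 0, 0, fun _ _ => 0, fun _ _ => 0, hγ₀, hε, hlow, hup⟩

/-- **(μ_cof^box,vol)-Ax ⟹ (μ_cof^vol)-Ax** (box letters pay run letters: the (1.21) box letter at `recordTermsAx` pays `RecordPolLimitOnRunsAx`, (V-absmom-box) pays (V-absmom)).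
[cite: Balaban1987RG1, (0.20) p.256, (1.21) p.264 (bookkeeping)] -/
theorem k0PvolAbsMomentCofinalRadiiAx_of_box (H : K0PvolAbsMomentBoxCofinalRadiiAx) : K0PvolAbsMomentCofinalRadiiAx := by
  intro F a ha
  obtain ⟨a₀, ha₀, hle, γ₀, ε₂₉, M, hγ₀, hγh, hε, hlim, hvol⟩ := H F a ha
  exact ⟨a₀, ha₀, hle, γ₀, ε₂₉, M, hγ₀, hγh, hε, fun n gs _ hI k hk => hlim k (prefixOf gs k) (prefixOf_mem_box_of_inInterval hI hk),
    recordPvolAbsMomentOnRunsAx_of_box F a₀ ε₂₉ le_rfl hvol⟩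

/-- **THE BOX MOMENT DOOR SITS ABOVE BOTH ROADS**: (μ_cof^box)-Ax ⟹ (α_cof)-Ax ∧ (μ_cof)-Ax (hence also door (ρ_cof)-Ax by ✓`k0RunCofinalRadiiAx_of_k0AbsMomentCofinalRadiiAx`).
Recorded as ONE conjunction so that neither road is an idle twin of the other. [cite: Balaban1987RG1, Thm 1 p.259, Thm 3 p.264, (1.22) p.264, (5.42) p.297 (bookkeeping)] -/
theorem doors_of_k0AbsMomentBoxCofinalRadiiAx (H : K0AbsMomentBoxCofinalRadiiAx) :
    K0V23Stub3DoorSuppliersAx.K0BoxCofinalRadiiAx ∧ K0AbsMomentCofinalRadiiAx :=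
  ⟨k0BoxCofinalRadiiAx_of_k0AbsMomentBoxCofinalRadiiAx H, k0AbsMomentCofinalRadiiAx_of_box H⟩

/-- **(μ_cof^box,vol)-Ax ⟹ (μ_cof^box)-Ax ∧ (μ_cof^vol)-Ax**: Fatou on the box (`k0AbsMomentBoxCofinalRadiiAx_of_pvol`) and box letters ⟹ run letters
(`k0PvolAbsMomentCofinalRadiiAx_of_box`), as ONE conjunction. [cite: Balaban1987RG1, Thm 1 p.259, Thm 3 p.264, (0.20) p.256, (1.21)–(1.22) p.264, (5.42) p.297 (bookkeeping)] -/
theorem doors_of_k0PvolAbsMomentBoxCofinalRadiiAx (H : K0PvolAbsMomentBoxCofinalRadiiAx) :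
    K0AbsMomentBoxCofinalRadiiAx ∧ K0PvolAbsMomentCofinalRadiiAx :=
  ⟨k0AbsMomentBoxCofinalRadiiAx_of_pvol H, k0PvolAbsMomentCofinalRadiiAx_of_box H⟩

/-- ★★★ **(μ_cof^box)-Ax ⟹ THE CRUX DECL BY NAME through the (α_cof) closer** — box-uniform ABSOLUTE SECOND MOMENTS of the record's limit activities at COFINALLY
small radii suffice for K0ᴬ `Record13SepCoPHInhabitedAx` (stmt-QuantumFields-27238) on k0's box road (`record13SepCoPHInhabitedAx_of_k0BoxCofinalRadii`); a SECOND road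
beside §3's run road.  A HELPER, NOT a closer; K0ᴬ OPEN; the mass gap is NOT proved.
[cite: Balaban1987RG1, Thm 1 p.259, Thm 3 p.264, (1.22) p.264, (5.42) p.297; Balaban1985Variational, Thm 1 (8)–(9) p.279; Balaban1988Convergent, Thm 1 p.262] -/
theorem record13SepCoPHInhabitedAx_of_k0AbsMomentBoxCofinalRadiiAx (H : K0AbsMomentBoxCofinalRadiiAx) :
    Summit.QuantumFields.YangMills.Theses.BalabanUVNodes.Record13SepCoPHInhabitedAx :=
  K0V23Stub3DoorSuppliersAx.record13SepCoPHInhabitedAx_of_k0BoxCofinalRadii (doors_of_k0AbsMomentBoxCofinalRadiiAx H).1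

/-- ★★★ **THE FINITE-VOLUME, RATE-FREE BOX DOOR AT K0ᴬ BY NAME**: cofinally in the radius, the (1.21) limit on the box (pointwise in `z`) AND windowed absolute second
moments of the FINITE-VOLUME activities on the box, frequently in the volume ⟹ K0ᴬ.  CONDITIONAL helper; K0ᴬ OPEN; nothing of Bałaban discharged.
[cite: Balaban1987RG1, Thm 1 p.259, Thm 3 p.264, (1.20)–(1.22) p.264, (4.37) p.291, (5.42) p.297; Balaban1985Variational, Thm 1 (8)–(9) p.279; Balaban1988Convergent, Thm 1 p.262] -/
theorem record13SepCoPHInhabitedAx_of_k0PvolAbsMomentBoxCofinalRadiiAx (H : K0PvolAbsMomentBoxCofinalRadiiAx) :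
    Summit.QuantumFields.YangMills.Theses.BalabanUVNodes.Record13SepCoPHInhabitedAx :=
  record13SepCoPHInhabitedAx_of_k0AbsMomentBoxCofinalRadiiAx (doors_of_k0PvolAbsMomentBoxCofinalRadiiAx H).1

end Summit.QuantumFields.YangMills.Theorems.K0AxMomentRoad

end
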